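import Summits.ValiantsHypothesis.ValiantsHypothesis.Theorems.KPlusLogSqLawStaticPathHighTipsSteps
import Summits.ValiantsHypothesis.ValiantsHypothesis.Theorems.KPlusLogSqLawStaticPathLowTipsBetween

/-!
# Route «KPlusLogSqLaw» — parametric max-weight independent set on a path: THEOREM T′ mirrored, the λ-high tips — existence between a sub- and a super-window

HONEST FRAMING.  Helper toward the crux `WeakLifting` (item `stmt-ValiantsHypothesis-19561`, route `KPlusLogSqLaw`, cell `pub-symmetroid`,
seat val-sym-lift-p4 g21, 2026-08-29) on the line of its witness-plan stub `stub_tridiagonalSectorB` (tropical twin of the STATIC tridiagonal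
sector = parametric maximum-weight independent set on a path).  Mirror image of `…StaticPathLowTipsBetween` for the λ-HIGH tips (even–even half of
THEOREM T′, THEOREM-T.md §4): **`highTip_between`** — in general position, if a sub-window `[i, j₁]` and a super-window `[i, j₃]` both have a λ-high
tip, so does `[i, j₂]` (`j₁ ≤ j₂ ≤ j₃`): the λ-high-type pair of `[i, j₂]` whose vertex has the SMALLEST value of `y - λθ` is the tip
(`noBadHigh_typeI/II/III`).  Also `slope_ne_of_highType`, `highType_symm`.  Statements about a labelled line arrangement; nothing here asserts
anything about `WeakLifting`, `TropicalB`, `KPlusLogSqLaw`, the stub in its window, `MatrixDescartes` (stmt-ValiantsHypothesis-18050) or `VP ≠ VNP`.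
-/

set_option linter.dupNamespace false
set_option autoImplicit false

namespace Summit.ValiantsHypothesis.ValiantsHypothesis.Theorems.KPlusLogSqLaw

open Finset Classical

namespace StaticPathFold

noncomputable section

variable (a b : ℕ → ℝ)

section HighTips

variable (lam : ℝ) (S : ℕ → ℕ → Prop)

/-! ## The λ-high tip between a sub-window and a super-window having one -/

/-- the two lines of a λ-high-type pair have different slopes. [folklore] -/
theorem slope_ne_of_highType
    (hS : ∀ p q, S p q ↔
      ((Even p ∧ Even q ∧ ((a p < lam ∧ lam < a q) ∨ (a q < lam ∧ lam < a p))) ∨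
       (Odd (p + q) ∧ (if Even p then a q < a p else a p < a q) ∧ (if Even p then a p else a q) < lam) ∨
       (Odd (p + q) ∧ (if Even p then a p < a q else a q < a p) ∧ lam < (if Even p then a p else a q))))
    {u v : ℕ} (h : S u v) : a u ≠ a v := by
  rcases (hS u v).mp h with ⟨-, -, h⟩ | ⟨-, h, -⟩ | ⟨-, h, -⟩
  · rcases h with ⟨h1, h2⟩ | ⟨h1, h2⟩
    · exact ne_of_lt (h1.trans h2)
    · exact (ne_of_lt (h1.trans h2)).symm
  · split_ifs at h
    · exact (ne_of_lt h).symm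
    · exact ne_of_lt h
  · split_ifs at h
    · exact ne_of_lt h
    · exact (ne_of_lt h).symm

/-- the λ-high-type predicate is symmetric in the pair. [folklore] -/
theorem highType_symm
    (hS : ∀ p q, S p q ↔
      ((Even p ∧ Even q ∧ ((a p < lam ∧ lam < a q) ∨ (a q < lam ∧ lam < a p))) ∨
       (Odd (p + q) ∧ (if Even p then a q < a p else a p < a q) ∧ (if Even p then a p else a q) < lam) ∨
       (Odd (p + q) ∧ (if Even p then a p < a q else a q < a p) ∧ lam < (if Even p then a p else a q))))
    {u v : ℕ} (h : S u v) : S v u := by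
  rw [hS] at h ⊢
  rcases h with ⟨hu, hv, hstr⟩ | ⟨hodd, hs, hl⟩ | ⟨hodd, hs, hl⟩
  · exact Or.inl ⟨hv, hu, hstr.symm⟩
  · right; left
    refine ⟨by rw [add_comm]; exact hodd, ?_, ?_⟩
    · by_cases hue : Even u
      · have hvo : ¬ Even v := fun h => by rw [Nat.odd_add'] at hodd; exact (Nat.not_even_iff_odd.mpr (hodd.mpr hue)) h
        rw [if_pos hue] at hs; rw [if_neg hvo]; exact hs
      · have hve : Even v := by rw [Nat.odd_add] at hodd; exact hodd.mp (Nat.not_even_iff_odd.mp hue)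
        rw [if_neg hue] at hs; rw [if_pos hve]; exact hs
    · by_cases hue : Even u
      · have hvo : ¬ Even v := fun h => by rw [Nat.odd_add'] at hodd; exact (Nat.not_even_iff_odd.mpr (hodd.mpr hue)) h
        rw [if_pos hue] at hl; rw [if_neg hvo]; exact hl
      · have hve : Even v := by rw [Nat.odd_add] at hodd; exact hodd.mp (Nat.not_even_iff_odd.mp hue)
        rw [if_neg hue] at hl; rw [if_pos hve]; exact hl
  · right; right
    refine ⟨by rw [add_comm]; exact hodd, ?_, ?_⟩
    · by_cases hue : Even u
      · have hvo : ¬ Even v := fun h => by rw [Nat.odd_add'] at hodd; exact (Nat.not_even_iff_odd.mpr (hodd.mpr hue)) h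
        rw [if_pos hue] at hs; rw [if_neg hvo]; exact hs
      · have hve : Even v := by rw [Nat.odd_add] at hodd; exact hodd.mp (Nat.not_even_iff_odd.mp hue)
        rw [if_neg hue] at hs; rw [if_pos hve]; exact hs
    · by_cases hue : Even u
      · have hvo : ¬ Even v := fun h => by rw [Nat.odd_add'] at hodd; exact (Nat.not_even_iff_odd.mpr (hodd.mpr hue)) h
        rw [if_pos hue] at hl; rw [if_neg hvo]; exact hl
      · have hve : Even v := by rw [Nat.odd_add] at hodd; exact hodd.mp (Nat.not_even_iff_odd.mp hue)
        rw [if_neg hue] at hl; rw [if_pos hve]; exact hl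

/-- **EXISTENCE OF THE λ-HIGH TIP** (mirror of `lowTip_between`; hypothesis (B) of the signed counting lemma for the λ-high tips): in
general position, if the window `[i, j₂]` contains a λ-high-type pair (witnessed by a λ-high tip of a sub-window `[i, j₁]`) and its closed
corridor is nonempty (witnessed by the vertex of a λ-high tip of a super-window `[i, j₃]`), then `[i, j₂]` has a λ-high tip — namely the
λ-high-type pair of the window whose vertex has the SMALLEST value of `y - λθ`. [folklore] -/
theorem highTip_between
    (hS : ∀ p q, S p q ↔
      ((Even p ∧ Even q ∧ ((a p < lam ∧ lam < a q) ∨ (a q < lam ∧ lam < a p))) ∨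
       (Odd (p + q) ∧ (if Even p then a q < a p else a p < a q) ∧ (if Even p then a p else a q) < lam) ∨
       (Odd (p + q) ∧ (if Even p then a p < a q else a q < a p) ∧ lam < (if Even p then a p else a q))))
    (n : ℕ) (hslope : ∀ p q, p ≤ n → q ≤ n → p ≠ q → a p ≠ a q) (hlam : ∀ p, p ≤ n → a p ≠ lam)
    (hgp : ∀ p q t, p ≤ n → q ≤ n → t ≤ n → p ≠ q → t ≠ p → t ≠ q →
      L a b t ((b q - b p) / (a p - a q)) ≠ L a b p ((b q - b p) / (a p - a q)))
    (i j₁ j₂ j₃ : ℕ) (h12 : j₁ ≤ j₂) (h23 : j₂ ≤ j₃) (h3n : j₃ ≤ n)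
    (h1 : ∃ p q, i ≤ p ∧ p < q ∧ q ≤ j₁ ∧ S p q ∧
      ∀ t, i ≤ t → t ≤ j₁ → t ≠ p → t ≠ q → 0 < gap t (L a b p ((b q - b p) / (a p - a q))) (L a b t ((b q - b p) / (a p - a q))))
    (h3 : ∃ p q, i ≤ p ∧ p < q ∧ q ≤ j₃ ∧ S p q ∧
      ∀ t, i ≤ t → t ≤ j₃ → t ≠ p → t ≠ q → 0 < gap t (L a b p ((b q - b p) / (a p - a q))) (L a b t ((b q - b p) / (a p - a q)))) :
    ∃ p q, i ≤ p ∧ p < q ∧ q ≤ j₂ ∧ S p q ∧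
      ∀ t, i ≤ t → t ≤ j₂ → t ≠ p → t ≠ q → 0 < gap t (L a b p ((b q - b p) / (a p - a q))) (L a b t ((b q - b p) / (a p - a q))) := by
  -- (a) the λ-type candidates of the window
  obtain ⟨p₁, q₁, hp₁, hpq₁, hq₁, hS₁, -⟩ := h1
  set Cand := ((Icc i j₂) ×ˢ (Icc i j₂)).filter (fun uv : ℕ × ℕ => uv.1 ≠ uv.2 ∧ S uv.1 uv.2) with hCand
  have hne : Cand.Nonempty := by
    refine ⟨(p₁, q₁), ?_⟩
    rw [hCand, mem_filter, mem_product, mem_Icc, mem_Icc]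
    exact ⟨⟨⟨hp₁, by omega⟩, ⟨by omega, by omega⟩⟩, Nat.ne_of_lt hpq₁, hS₁⟩
  -- (b) a point of the closed corridor of `[i, j₂]`
  obtain ⟨p₃, q₃, hp₃, hpq₃, hq₃, hS₃, hG₃⟩ := h3
  set τ₃ := (b q₃ - b p₃) / (a p₃ - a q₃) with hτ₃
  set y₃ := L a b p₃ τ₃ with hy₃
  have hA₃ : a p₃ ≠ a q₃ := slope_ne_of_highType a lam S hS hS₃
  have hwit : ∀ t, i ≤ t → t ≤ j₂ → (Even t → y₃ ≤ L a b t τ₃) ∧ (¬ Even t → L a b t τ₃ ≤ y₃) := by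
    intro t ht1 ht2
    by_cases htp : t = p₃
    · subst htp; exact ⟨fun _ => le_rfl, fun _ => le_rfl⟩
    by_cases htq : t = q₃
    · subst htq
      have : L a b t τ₃ = y₃ := by rw [hy₃, hτ₃]; exact L_eq_L_crossAbs a b hA₃
      rw [this]; exact ⟨fun _ => le_rfl, fun _ => le_rfl⟩
    exact weak_of_gap_pos (hG₃ t ht1 (by omega) htp htq)
  -- (c) the candidate with the largest functional value
  obtain ⟨⟨u, v⟩, hmem, hmin⟩ := exists_min_image Cand
    (fun uv : ℕ × ℕ => L a b uv.1 ((b uv.2 - b uv.1) / (a uv.1 - a uv.2)) - lam * ((b uv.2 - b uv.1) / (a uv.1 - a uv.2))) hne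
  rw [hCand, mem_filter, mem_product, mem_Icc, mem_Icc] at hmem
  obtain ⟨⟨⟨hiu, huj⟩, ⟨hiv, hvj⟩⟩, huv, hSuv⟩ := hmem
  simp only at hiu huj hiv hvj huv hSuv hmin
  set τ₀ := (b v - b u) / (a u - a v) with hτ₀
  set y₀ := L a b u τ₀ with hy₀
  have hAuv : a u ≠ a v := slope_ne_of_highType a lam S hS hSuv
  have hyv : L a b v τ₀ = y₀ := by rw [hy₀, hτ₀]; exact L_eq_L_crossAbs a b hAuv
  have hun : u ≤ n := by omega
  have hvn : v ≤ n := by omega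
  -- minimality over the λ-high-type pairs among three given indices of the window
  have hmin3 : ∀ t, i ≤ t → t ≤ j₂ → ∀ x y, (x = t ∨ x = u ∨ x = v) → (y = t ∨ y = u ∨ y = v) → S x y →
      L a b u τ₀ - lam * τ₀ ≤ L a b x ((b y - b x) / (a x - a y)) - lam * ((b y - b x) / (a x - a y)) := by
    intro t ht1 ht2 x y hx hy hSxy
    have hxy : x ≠ y := by
      intro h; have := slope_ne_of_highType a lam S hS hSxy; rw [h] at this; exact this rfl
    have hmemxy : (x, y) ∈ Cand := by
      rw [hCand, mem_filter, mem_product, mem_Icc, mem_Icc]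
      refine ⟨⟨⟨?_, ?_⟩, ⟨?_, ?_⟩⟩, hxy, hSxy⟩
      · rcases hx with h | h | h <;> omega
      · rcases hx with h | h | h <;> omega
      · rcases hy with h | h | h <;> omega
      · rcases hy with h | h | h <;> omega
    exact hmin (x, y) hmemxy
  -- (d) every other line of the window is strictly on its correct side of the vertex
  have hgood : ∀ t, i ≤ t → t ≤ j₂ → t ≠ u → t ≠ v → 0 < gap t y₀ (L a b t τ₀) := by
    intro t ht1 ht2 htu htv
    have htn : t ≤ n := by omega
    by_contra hng
    have hne_val : L a b t τ₀ ≠ y₀ := by rw [hy₀, hτ₀]; exact hgp u v t hun hvn htn huv htu htv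
    have hbad : (Even t ∧ L a b t τ₀ < y₀) ∨ (¬ Even t ∧ y₀ < L a b t τ₀) := by
      unfold gap at hng
      by_cases hte : Even t
      · rw [if_pos hte, sub_pos, not_lt] at hng; exact Or.inl ⟨hte, lt_of_le_of_ne hng hne_val⟩
      · rw [if_neg hte, sub_pos, not_lt] at hng; exact Or.inr ⟨hte, lt_of_le_of_ne hng hne_val.symm⟩
    have hAtu : a t ≠ a u := hslope t u htn hun htu
    have hAtv : a t ≠ a v := hslope t v htn hvn htv
    have hlt : a t ≠ lam := hlam t htn
    have hm := hmin3 t ht1 ht2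
    have hw := hwit t ht1 ht2
    rcases (hS u v).mp hSuv with ⟨hue', hve', hstr⟩ | ⟨hodd, hs, hl⟩ | ⟨hodd, hs, hl⟩
    · rcases hstr with ⟨h1', h2'⟩ | ⟨h1', h2'⟩
      · exact noBadHigh_typeI a b lam S hS hue' hve' h1' h2' hAtu hAtv hlt hbad hm
          ⟨τ₃, y₃, (hwit u hiu huj).1 hue', (hwit v hiv hvj).1 hve', hw⟩
      · -- roles swapped: `e₁ = v`, `e₂ = u`
        have e0 : (b u - b v) / (a v - a u) = τ₀ := by rw [hτ₀]; exact crossAbs_symm a b v u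
        refine noBadHigh_typeI a b lam S hS hve' hue' h1' h2' hAtv hAtu hlt ?_ ?_
          ⟨τ₃, y₃, (hwit v hiv hvj).1 hve', (hwit u hiu huj).1 hue', hw⟩
        · rw [e0, hyv]; exact hbad
        · intro x y hx hy hSxy
          rw [e0, hyv]
          exact hm x y (hx.imp_right Or.symm) (hy.imp_right Or.symm) hSxy
    · by_cases hue : Even u
      · rw [if_pos hue] at hs hl
        have hvo : ¬ Even v := fun h => by rw [Nat.odd_add'] at hodd; exact (Nat.not_even_iff_odd.mpr (hodd.mpr hue)) h
        exact noBadHigh_typeII a b lam S hS hue hvo hs hl hAtu hAtv hlt hbad hm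
          ⟨τ₃, y₃, (hwit u hiu huj).1 hue, (hwit v hiv hvj).2 hvo, hw⟩
      · rw [if_neg hue] at hs hl
        have hve : Even v := by rw [Nat.odd_add] at hodd; exact hodd.mp (Nat.not_even_iff_odd.mp hue)
        have e0 : (b u - b v) / (a v - a u) = τ₀ := by rw [hτ₀]; exact crossAbs_symm a b v u
        refine noBadHigh_typeII a b lam S hS hve hue hs hl hAtv hAtu hlt ?_ ?_
          ⟨τ₃, y₃, (hwit v hiv hvj).1 hve, (hwit u hiu huj).2 hue, hw⟩
        · rw [e0, hyv]; exact hbad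
        · intro x y hx hy hSxy; rw [e0, hyv]; exact hm x y (hx.imp_right Or.symm) (hy.imp_right Or.symm) hSxy
    · by_cases hue : Even u
      · rw [if_pos hue] at hs hl
        have hvo : ¬ Even v := fun h => by rw [Nat.odd_add'] at hodd; exact (Nat.not_even_iff_odd.mpr (hodd.mpr hue)) h
        exact noBadHigh_typeIII a b lam S hS hue hvo hs hl hAtu hAtv hlt hbad hm
          ⟨τ₃, y₃, (hwit u hiu huj).1 hue, (hwit v hiv hvj).2 hvo, hw⟩
      · rw [if_neg hue] at hs hl
        have hve : Even v := by rw [Nat.odd_add] at hodd; exact hodd.mp (Nat.not_even_iff_odd.mp hue)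
        have e0 : (b u - b v) / (a v - a u) = τ₀ := by rw [hτ₀]; exact crossAbs_symm a b v u
        refine noBadHigh_typeIII a b lam S hS hve hue hs hl hAtv hAtu hlt ?_ ?_
          ⟨τ₃, y₃, (hwit v hiv hvj).1 hve, (hwit u hiu huj).2 hue, hw⟩
        · rw [e0, hyv]; exact hbad
        · intro x y hx hy hSxy; rw [e0, hyv]; exact hm x y (hx.imp_right Or.symm) (hy.imp_right Or.symm) hSxy
  -- (e) the tip, as an ordered pair
  rcases lt_or_gt_of_ne huv with hlt | hgt
  · exact ⟨u, v, hiu, hlt, hvj, hSuv, fun t h1 h2 h3 h4 => hgood t h1 h2 h3 h4⟩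
  · refine ⟨v, u, hiv, hgt, huj, highType_symm a lam S hS hSuv, fun t h1 h2 h3 h4 => ?_⟩
    have e0 : (b u - b v) / (a v - a u) = τ₀ := by rw [hτ₀]; exact crossAbs_symm a b v u
    rw [e0, hyv]; exact hgood t h1 h2 h4 h3

end HighTips

end

end StaticPathFold

end Summit.ValiantsHypothesis.ValiantsHypothesis.Theorems.KPlusLogSqLaw
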